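import Summits.Ventures.Crystal3D.Theorems.StickyWulffConstantGenericWallFloorKissingGap
import HarnessLib

/-!
# Model data for the h-row END analysis: the star slots of `u₀ = (1,0,0)`, their coordinates, adjacencies and the vertical pairs
# (crux `GenericWallFloor`, stmt-Ventures-19480, kernel G; fourth brick of TRACK 2′ = the structural proof of `HRowEndFarApart (3/4)`; 19480-p2 g14)

HONEST FRAMING. Venture `Summits/Ventures/Crystal3D` (cell `crystal3d-full`), route `route-Ventures-StickyWulffConstant`, helper for the crux
`GenericWallFloor` (stmt-Ventures-19480) / consumer `TextureLiminfV5` (stmt-Ventures-23912).  Concrete coordinate facts about named slots of `Λ₀`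
(private abbreviations `u₀, t₁, …`); standard axioms; F-C1 not moved.

THE POINT.  In the model frame with the row direction `u₀ = (1,0,0)`, the h-slots adjacent to `u₀` (`⟪s, u₀⟫ = ½`) are exactly the two equatorial
ones `t₁ = (½, √3/2, 0)`, `t₂ = (½, −√3/2, 0)`, the upper `t₃ = (½, √3/6, √(2/3))` and its basal mirror `t₄` (`hcp_adjacent_cases`); the polar
neighbours of `t₂` are `t₅ = (0, −√3/3, √(2/3))` and its mirror `t₆`; `(t₃, t₄)` and `(t₅, t₆)` are VERTICAL pairs (`tᵢ − tⱼ = 2√(2/3)·e₃`, inner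
product `−1/3` — impossible inside a cuboctahedron, axis-revealing inside a twin dozen); and the inner products of the star directions `tᵢ − u₀` with an
arbitrary `d` in the rational variables `(d 0, (√3/2)·d 1, √(2/3)·d 2)` of `…HRowEndTrig`.
WHAT THIS IS NOT: nothing about configurations beyond `hcpSlots` membership; F-C1 not moved.
-/

noncomputable section

namespace Summit.Ventures.Crystal3D.Theorems

open Finset
open Literature.MathematicalPhysics.StatisticalMechanics
open scoped InnerProductSpace

namespace HRowEndModel

/-- The row direction `u₀ = (1,0,0)`. -/
def u₀ : EuclideanSpace ℝ (Fin 3) := barlowPos 1 (Real.sqrt (2 / 3)) constHagg 0 1 0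
/-- `t₁ = (½, √3/2, 0)`. -/
def t₁ : EuclideanSpace ℝ (Fin 3) := barlowPos 1 (Real.sqrt (2 / 3)) constHagg 0 0 1
/-- `t₂ = (½, −√3/2, 0)`. -/
def t₂ : EuclideanSpace ℝ (Fin 3) := barlowPos 1 (Real.sqrt (2 / 3)) constHagg 0 1 (-1)
/-- `t₃ = (½, √3/6, √(2/3))` (upper, adjacent to `u₀` and `t₁`). -/
def t₃ : EuclideanSpace ℝ (Fin 3) := barlowPos 1 (Real.sqrt (2 / 3)) constHagg 1 0 0
/-- `t₄ = basalMirror t₃`. -/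
def t₄ : EuclideanSpace ℝ (Fin 3) := basalMirror t₃
/-- `t₅ = (0, −√3/3, √(2/3))` (upper, adjacent to `t₂`, orthogonal to `u₀`). -/
def t₅ : EuclideanSpace ℝ (Fin 3) := barlowPos 1 (Real.sqrt (2 / 3)) constHagg 1 0 (-1)
/-- `t₆ = basalMirror t₅`. -/
def t₆ : EuclideanSpace ℝ (Fin 3) := basalMirror t₅
/-- `o₋ = (0, √3/3, −√(2/3))` (lower slot orthogonal to `u₀`: the octahedral arrival direction, lower sign). -/
def oL : EuclideanSpace ℝ (Fin 3) := barlowPos 1 (Real.sqrt (2 / 3)) constHagg (-1) 0 1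
/-- `o₊ = basalMirror o₋ = (0, √3/3, √(2/3))`. -/
def oU : EuclideanSpace ℝ (Fin 3) := basalMirror oL

/-! ### Coordinates -/

/-- `√(2/3) > 0`. -/
theorem sqrt23_pos : 0 < Real.sqrt (2 / 3) := Real.sqrt_pos.2 (by norm_num)
/-- Model fact `sqrt23_sq` (coordinates / membership / inner product of the named slots). -/
theorem sqrt23_sq : Real.sqrt (2 / 3) ^ 2 = 2 / 3 := Real.sq_sqrt (by norm_num)
/-- Model fact `sqrt3_sq` (coordinates / membership / inner product of the named slots). -/
theorem sqrt3_sq : Real.sqrt 3 ^ 2 = 3 := Real.sq_sqrt (by norm_num)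

/-- Model fact `u₀_apply` (coordinates / membership / inner product of the named slots). -/
theorem u₀_apply : u₀ 0 = 1 ∧ u₀ 1 = 0 ∧ u₀ 2 = 0 := by
  refine ⟨?_, ?_, ?_⟩ <;> simp [u₀]
/-- Model fact `t₁_apply` (coordinates / membership / inner product of the named slots). -/
theorem t₁_apply : t₁ 0 = 1 / 2 ∧ t₁ 1 = Real.sqrt 3 / 2 ∧ t₁ 2 = 0 := by
  refine ⟨?_, ?_, ?_⟩ <;> simp [t₁]
/-- Model fact `t₂_apply` (coordinates / membership / inner product of the named slots). -/
theorem t₂_apply : t₂ 0 = 1 / 2 ∧ t₂ 1 = -(Real.sqrt 3 / 2) ∧ t₂ 2 = 0 := by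
  refine ⟨?_, ?_, ?_⟩ <;> simp [t₂]; ring
/-- Model fact `t₃_apply` (coordinates / membership / inner product of the named slots). -/
theorem t₃_apply : t₃ 0 = 1 / 2 ∧ t₃ 1 = Real.sqrt 3 / 6 ∧ t₃ 2 = Real.sqrt (2 / 3) := by
  refine ⟨?_, ?_, ?_⟩ <;> simp [t₃, haggLabel_const]; ring
/-- Model fact `t₄_apply` (coordinates / membership / inner product of the named slots). -/
theorem t₄_apply : t₄ 0 = 1 / 2 ∧ t₄ 1 = Real.sqrt 3 / 6 ∧ t₄ 2 = -Real.sqrt (2 / 3) := by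
  refine ⟨?_, ?_, ?_⟩ <;> simp [t₄, t₃, basalMirror_apply_coord, haggLabel_const]; ring
/-- Model fact `t₅_apply` (coordinates / membership / inner product of the named slots). -/
theorem t₅_apply : t₅ 0 = 0 ∧ t₅ 1 = -(Real.sqrt 3 / 3) ∧ t₅ 2 = Real.sqrt (2 / 3) := by
  refine ⟨?_, ?_, ?_⟩ <;> simp [t₅, haggLabel_const] <;> ring
/-- Model fact `t₆_apply` (coordinates / membership / inner product of the named slots). -/
theorem t₆_apply : t₆ 0 = 0 ∧ t₆ 1 = -(Real.sqrt 3 / 3) ∧ t₆ 2 = -Real.sqrt (2 / 3) := by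
  refine ⟨?_, ?_, ?_⟩ <;> simp [t₆, t₅, basalMirror_apply_coord, haggLabel_const] <;> ring
/-- Model fact `oL_apply` (coordinates / membership / inner product of the named slots). -/
theorem oL_apply : oL 0 = 0 ∧ oL 1 = Real.sqrt 3 / 3 ∧ oL 2 = -Real.sqrt (2 / 3) := by
  refine ⟨?_, ?_, ?_⟩ <;> simp [oL, haggLabel_const] <;> ring
/-- Model fact `oU_apply` (coordinates / membership / inner product of the named slots). -/
theorem oU_apply : oU 0 = 0 ∧ oU 1 = Real.sqrt 3 / 3 ∧ oU 2 = Real.sqrt (2 / 3) := by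
  refine ⟨?_, ?_, ?_⟩ <;> simp [oU, oL, basalMirror_apply_coord, haggLabel_const] <;> ring

/-- Inner product in coordinates. -/
theorem inner_fin3 (x y : EuclideanSpace ℝ (Fin 3)) : ⟪x, y⟫_ℝ = x 0 * y 0 + x 1 * y 1 + x 2 * y 2 := by
  rw [EuclideanSpace.inner_eq_star_dotProduct]
  simp [dotProduct, Fin.sum_univ_three]; ring

/-- Norm in coordinates. -/
theorem norm_sq_fin3 (x : EuclideanSpace ℝ (Fin 3)) : ‖x‖ ^ 2 = x 0 ^ 2 + x 1 ^ 2 + x 2 ^ 2 := by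
  rw [EuclideanSpace.real_norm_sq_eq, Fin.sum_univ_three]

/-! ### Memberships -/

/-- `u₀ ∈ fccSlots`. -/
theorem u₀_mem : u₀ ∈ fccSlots := by rw [u₀, fccSlots, mem_image]; exact ⟨(0, 1, 0), by simp [fccSlotTriples], rfl⟩
/-- Model fact `t₁_mem` (coordinates / membership / inner product of the named slots). -/
theorem t₁_mem : t₁ ∈ fccSlots := by rw [t₁, fccSlots, mem_image]; exact ⟨(0, 0, 1), by simp [fccSlotTriples], rfl⟩
/-- Model fact `t₂_mem` (coordinates / membership / inner product of the named slots). -/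
theorem t₂_mem : t₂ ∈ fccSlots := by rw [t₂, fccSlots, mem_image]; exact ⟨(0, 1, -1), by simp [fccSlotTriples], rfl⟩
/-- Model fact `t₃_mem` (coordinates / membership / inner product of the named slots). -/
theorem t₃_mem : t₃ ∈ fccSlots := by rw [t₃, fccSlots, mem_image]; exact ⟨(1, 0, 0), by simp [fccSlotTriples], rfl⟩
/-- Model fact `t₅_mem` (coordinates / membership / inner product of the named slots). -/
theorem t₅_mem : t₅ ∈ fccSlots := by rw [t₅, fccSlots, mem_image]; exact ⟨(1, 0, -1), by simp [fccSlotTriples], rfl⟩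
/-- Model fact `oL_mem` (coordinates / membership / inner product of the named slots). -/
theorem oL_mem : oL ∈ fccSlots := by rw [oL, fccSlots, mem_image]; exact ⟨(-1, 0, 1), by simp [fccSlotTriples], rfl⟩
/-- Model fact `u₀_two` (coordinates / membership / inner product of the named slots). -/
theorem u₀_two : u₀ 2 = 0 := u₀_apply.2.2

/-- Model fact `u₀_hcp` (coordinates / membership / inner product of the named slots). -/
theorem u₀_hcp : u₀ ∈ hcpSlots := mem_hcpSlots_of_inPlane u₀_mem u₀_two
/-- Model fact `t₁_hcp` (coordinates / membership / inner product of the named slots). -/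
theorem t₁_hcp : t₁ ∈ hcpSlots := mem_hcpSlots_of_upper t₁_mem (by rw [t₁_apply.2.2])
/-- Model fact `t₂_hcp` (coordinates / membership / inner product of the named slots). -/
theorem t₂_hcp : t₂ ∈ hcpSlots := mem_hcpSlots_of_upper t₂_mem (by rw [t₂_apply.2.2])
/-- Model fact `t₃_hcp` (coordinates / membership / inner product of the named slots). -/
theorem t₃_hcp : t₃ ∈ hcpSlots := mem_hcpSlots_of_upper t₃_mem (by rw [t₃_apply.2.2]; exact sqrt23_pos.le)
/-- Model fact `t₄_hcp` (coordinates / membership / inner product of the named slots). -/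
theorem t₄_hcp : t₄ ∈ hcpSlots := basalMirror_mem_hcpSlots_of_upper t₃_mem (by rw [t₃_apply.2.2]; exact sqrt23_pos.le)
/-- Model fact `t₅_hcp` (coordinates / membership / inner product of the named slots). -/
theorem t₅_hcp : t₅ ∈ hcpSlots := mem_hcpSlots_of_upper t₅_mem (by rw [t₅_apply.2.2]; exact sqrt23_pos.le)
/-- Model fact `t₆_hcp` (coordinates / membership / inner product of the named slots). -/
theorem t₆_hcp : t₆ ∈ hcpSlots := basalMirror_mem_hcpSlots_of_upper t₅_mem (by rw [t₅_apply.2.2]; exact sqrt23_pos.le)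

/-- The slots of the analysis as model slots of the basal twin: `−t₃, u₀ − t₃, t₁ − t₃, oL, t₂ − u₀ + oL, t₃ − u₀ + oL ∈ fccSlots`, via coordinates. -/
theorem neg_t₃_mem : -t₃ ∈ fccSlots := neg_mem_fccSlots t₃_mem

/-! ### Inner products among the named slots (all by coordinates) -/

/-- Inner product from coordinates. -/
private theorem ip {x y : EuclideanSpace ℝ (Fin 3)} {a b c a' b' c' : ℝ} (hx : x 0 = a ∧ x 1 = b ∧ x 2 = c) (hy : y 0 = a' ∧ y 1 = b' ∧ y 2 = c') :
    ⟪x, y⟫_ℝ = a * a' + b * b' + c * c' := by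
  rw [inner_fin3, hx.1, hx.2.1, hx.2.2, hy.1, hy.2.1, hy.2.2]

/-- Model fact `inner_t₁_u₀` (coordinates / membership / inner product of the named slots). -/
theorem inner_t₁_u₀ : ⟪t₁, u₀⟫_ℝ = 1 / 2 := by rw [ip t₁_apply u₀_apply]; ring
/-- Model fact `inner_t₂_u₀` (coordinates / membership / inner product of the named slots). -/
theorem inner_t₂_u₀ : ⟪t₂, u₀⟫_ℝ = 1 / 2 := by rw [ip t₂_apply u₀_apply]; ring
/-- Model fact `inner_t₃_u₀` (coordinates / membership / inner product of the named slots). -/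
theorem inner_t₃_u₀ : ⟪t₃, u₀⟫_ℝ = 1 / 2 := by rw [ip t₃_apply u₀_apply]; ring
/-- Model fact `inner_t₄_u₀` (coordinates / membership / inner product of the named slots). -/
theorem inner_t₄_u₀ : ⟪t₄, u₀⟫_ℝ = 1 / 2 := by rw [ip t₄_apply u₀_apply]; ring
/-- Model fact `inner_t₃_t₁` (coordinates / membership / inner product of the named slots). -/
theorem inner_t₃_t₁ : ⟪t₃, t₁⟫_ℝ = 1 / 2 := by rw [ip t₃_apply t₁_apply]; nlinarith [sqrt3_sq]
/-- Model fact `inner_t₄_t₁` (coordinates / membership / inner product of the named slots). -/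
theorem inner_t₄_t₁ : ⟪t₄, t₁⟫_ℝ = 1 / 2 := by rw [ip t₄_apply t₁_apply]; nlinarith [sqrt3_sq]
/-- Model fact `inner_t₅_t₂` (coordinates / membership / inner product of the named slots). -/
theorem inner_t₅_t₂ : ⟪t₅, t₂⟫_ℝ = 1 / 2 := by rw [ip t₅_apply t₂_apply]; nlinarith [sqrt3_sq]
/-- Model fact `inner_t₆_t₂` (coordinates / membership / inner product of the named slots). -/
theorem inner_t₆_t₂ : ⟪t₆, t₂⟫_ℝ = 1 / 2 := by rw [ip t₆_apply t₂_apply]; nlinarith [sqrt3_sq]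
/-- Model fact `inner_t₃_t₄` (coordinates / membership / inner product of the named slots). -/
theorem inner_t₃_t₄ : ⟪t₃, t₄⟫_ℝ = -1 / 3 := by rw [ip t₃_apply t₄_apply]; nlinarith [sqrt3_sq, sqrt23_sq]
/-- Model fact `inner_t₅_t₆` (coordinates / membership / inner product of the named slots). -/
theorem inner_t₅_t₆ : ⟪t₅, t₆⟫_ℝ = -1 / 3 := by rw [ip t₅_apply t₆_apply]; nlinarith [sqrt3_sq, sqrt23_sq]
/-- Model fact `t₃_sub_t₄` (coordinates / membership / inner product of the named slots). -/
theorem t₃_sub_t₄ : t₃ - t₄ = (2 * Real.sqrt (2 / 3)) • EuclideanSpace.single (2 : Fin 3) (1 : ℝ) := by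
  ext i; fin_cases i <;> simp [t₃_apply.1, t₃_apply.2.1, t₃_apply.2.2, t₄_apply.1, t₄_apply.2.1, t₄_apply.2.2]; ring
/-- Model fact `t₅_sub_t₆` (coordinates / membership / inner product of the named slots). -/
theorem t₅_sub_t₆ : t₅ - t₆ = (2 * Real.sqrt (2 / 3)) • EuclideanSpace.single (2 : Fin 3) (1 : ℝ) := by
  ext i; fin_cases i <;> simp [t₅_apply.1, t₅_apply.2.1, t₅_apply.2.2, t₆_apply.1, t₆_apply.2.1, t₆_apply.2.2]; ring

/-- Norms of unit slots via membership. -/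
theorem norm_t₄ : ‖t₄‖ = 1 := norm_eq_one_of_mem_hcpSlots t₄_hcp
/-- Model fact `norm_t₆` (coordinates / membership / inner product of the named slots). -/
theorem norm_t₆ : ‖t₆‖ = 1 := norm_eq_one_of_mem_hcpSlots t₆_hcp

/-! ### The h-slots adjacent to `u₀` -/

/-- `⟪x, u₀⟫ = x 0`. -/
theorem inner_u₀_eq (x : EuclideanSpace ℝ (Fin 3)) : ⟪x, u₀⟫_ℝ = x 0 := by
  rw [inner_fin3, u₀_apply.1, u₀_apply.2.1, u₀_apply.2.2]; ring

/-- Triple arithmetic: the slots with first coordinate `½` on or above the basal plane (kernel-decided). -/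
theorem triples_adjacent : ∀ c ∈ fccSlotTriples, 2 * c.2.1 + c.2.2 + c.1 = 1 → 0 ≤ c.1 →
    c = (0, 0, 1) ∨ c = (0, 1, -1) ∨ c = (1, 0, 0) := by decide

/-- A slot with first coordinate `½` on or above the basal plane is `t₁`, `t₂` or `t₃`. -/
theorem upper_adjacent_cases {s : EuclideanSpace ℝ (Fin 3)} (hs : s ∈ fccSlots) (hs2 : 0 ≤ s 2) (h : s 0 = 1 / 2) :
    s = t₁ ∨ s = t₂ ∨ s = t₃ := by
  have hc := sqrt23_pos
  rw [fccSlots, mem_image] at hs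
  obtain ⟨c, hcm, rfl⟩ := hs
  rw [barlowPos_apply_zero, haggLabel_const] at h
  rw [barlowPos_apply_two] at hs2
  have h1 : (2 * c.2.1 + c.2.2 + c.1 : ℤ) = 1 := by
    have : (2 * c.2.1 + c.2.2 + c.1 : ℝ) = 1 := by linarith
    exact_mod_cast this
  have h2 : (0 : ℤ) ≤ c.1 := by
    have : (0 : ℝ) ≤ c.1 := by
      by_contra hneg; push Not at hneg
      have : (c.1 : ℝ) * Real.sqrt (2 / 3) < 0 := mul_neg_of_neg_of_pos hneg hc
      linarith
    exact_mod_cast this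
  rcases triples_adjacent c hcm h1 h2 with rfl | rfl | rfl
  · exact Or.inl rfl
  · exact Or.inr (Or.inl rfl)
  · exact Or.inr (Or.inr rfl)

/-- **The h-slots adjacent to `u₀` are `t₁, t₂, t₃, t₄`.** -/
theorem hcp_adjacent_cases {s : EuclideanSpace ℝ (Fin 3)} (hs : s ∈ hcpSlots) (h : ⟪s, u₀⟫_ℝ = 1 / 2) :
    s = t₁ ∨ s = t₂ ∨ s = t₃ ∨ s = t₄ := by
  rw [inner_u₀_eq] at h
  rcases mem_hcpSlots.1 hs with ⟨hs', hs2⟩ | ⟨t, ⟨ht, ht2⟩, rfl⟩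
  · rcases upper_adjacent_cases hs' hs2 h with h1 | h1 | h1
    · exact Or.inl h1
    · exact Or.inr (Or.inl h1)
    · exact Or.inr (Or.inr (Or.inl h1))
  · have h0 : t 0 = 1 / 2 := by rw [basalMirror_apply_coord] at h; simpa using h
    rcases upper_adjacent_cases ht ht2 h0 with rfl | rfl | rfl
    · exact Or.inl (basalMirror_of_inPlane t₁_apply.2.2)
    · exact Or.inr (Or.inl (basalMirror_of_inPlane t₂_apply.2.2))
    · exact Or.inr (Or.inr (Or.inr rfl))

end HRowEndModel

end Summit.Ventures.Crystal3D.Theorems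

end
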